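import Mathlib.GroupTheory.Perm.Sign
import Mathlib.Tactic.Group
import Literature.Topology.FourManifolds.BalancedPresentation
import HarnessLib

/-!
# Andrews–Curtis equivalence: conjugation by words, endomorphisms, permuting the relators

API for the tree's Andrews–Curtis relation `Literature.Topology.FourManifolds.IsAndrewsCurtisEquivalent`
(`BalancedPresentation.lean`; generated by the three relator moves of Andrews–Curtis (1965):
`rᵢ ↦ rᵢ⁻¹`, `rᵢ ↦ rᵢ rⱼ` (`j ≠ i`), `rᵢ ↦ x rᵢ x⁻¹` with `x` a generator). Everything is proved:

* `IsAndrewsCurtisEquivalent.update_conj` — conjugating one relator by an ARBITRARY word is an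
  Andrews–Curtis equivalence (induction on the word; conjugation by `x⁻¹` is the inverse move);
* `AndrewsCurtisMove.map`, `IsAndrewsCurtisEquivalent.map` — applying any endomorphism of the free
  group to all relators preserves Andrews–Curtis equivalence, and
  `IsAndrewsCurtisEquivalent.comp_of_trivial` (an endomorphism fixing the triviality of the trivial
  presentation preserves Andrews–Curtis triviality);
* `IsAndrewsCurtisEquivalent.comp_swap`, `IsAndrewsCurtisEquivalent.comp_perm` — permuting the
  relators is an Andrews–Curtis equivalence (a transposition is seven moves), with the two-entry
  bookkeeping lemmas `BalancedPresentation.update₂_*`.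

These are the standard remarks that the auxiliary moves "conjugate by any word" and "permute the
relators", which many authors add to the Andrews–Curtis moves, do not change the equivalence
relation. Used by `BalancedPresentationBasisChange.lean` (changes of free basis) and the barrier
`Literature/Barriers/SmoothPoincare4/PropertyTwoRAndrewsCurtis.lean`.

## References

* J. J. Andrews, M. L. Curtis, *Free groups and handlebodies*, Proc. AMS 16 (1965) 192–195.
  [AndrewsCurtis1965]
-/

noncomputable section

open Function

namespace Literature.Topology.FourManifolds

variable {n : ℕ}

/-! ### Basic API of the Andrews–Curtis relation -/

namespace IsAndrewsCurtisEquivalent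

/-- Andrews–Curtis equivalence is reflexive. [folklore] -/
protected theorem refl (P : BalancedPresentation n) : IsAndrewsCurtisEquivalent P P :=
  Relation.EqvGen.refl P

/-- Andrews–Curtis equivalence is symmetric. [folklore] -/
protected theorem symm {P Q : BalancedPresentation n} (h : IsAndrewsCurtisEquivalent P Q) :
    IsAndrewsCurtisEquivalent Q P :=
  Relation.EqvGen.symm _ _ h

/-- Andrews–Curtis equivalence is transitive. [folklore] -/
protected theorem trans {P Q R : BalancedPresentation n} (h₁ : IsAndrewsCurtisEquivalent P Q)
    (h₂ : IsAndrewsCurtisEquivalent Q R) : IsAndrewsCurtisEquivalent P R :=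
  Relation.EqvGen.trans _ _ _ h₁ h₂

end IsAndrewsCurtisEquivalent

/-- A single Andrews–Curtis move is an Andrews–Curtis equivalence. [folklore] -/
theorem AndrewsCurtisMove.isAndrewsCurtisEquivalent {P Q : BalancedPresentation n}
    (h : AndrewsCurtisMove P Q) : IsAndrewsCurtisEquivalent P Q :=
  Relation.EqvGen.rel _ _ h

namespace IsAndrewsCurtisEquivalent

/-- Move `rᵢ ↦ rᵢ⁻¹` as an equivalence. (Andrews–Curtis 1965.) [cite: AndrewsCurtis1965] -/
theorem update_inv (P : BalancedPresentation n) (i : Fin n) :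
    IsAndrewsCurtisEquivalent P (update P i (P i)⁻¹) :=
  (AndrewsCurtisMove.inv P i).isAndrewsCurtisEquivalent

/-- Move `rᵢ ↦ rᵢ rⱼ` (`i ≠ j`) as an equivalence. (Andrews–Curtis 1965.) [cite: AndrewsCurtis1965] -/
theorem update_mul (P : BalancedPresentation n) {i j : Fin n} (h : i ≠ j) :
    IsAndrewsCurtisEquivalent P (update P i (P i * P j)) :=
  (AndrewsCurtisMove.mul P i j h).isAndrewsCurtisEquivalent

/-- Move `rᵢ ↦ x rᵢ x⁻¹` (`x` a generator) as an equivalence. (Andrews–Curtis 1965.)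
[cite: AndrewsCurtis1965] -/
theorem update_conj_of (P : BalancedPresentation n) (i g : Fin n) :
    IsAndrewsCurtisEquivalent P (update P i (FreeGroup.of g * P i * (FreeGroup.of g)⁻¹)) :=
  (AndrewsCurtisMove.conj P i g).isAndrewsCurtisEquivalent

/-- **Conjugating one relator by an arbitrary word is an Andrews–Curtis equivalence**: the
word is a product of generators and their inverses, conjugation by `x⁻¹` being the inverse of
the move "conjugate by `x`". [folklore] -/
theorem update_conj (P : BalancedPresentation n) (i : Fin n) (w : FreeGroup (Fin n)) :
    IsAndrewsCurtisEquivalent P (update P i (w * P i * w⁻¹)) := by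
  induction w generalizing P with
  | C1 => simpa using IsAndrewsCurtisEquivalent.refl P
  | of x => exact update_conj_of P i x
  | inv_of x _ =>
    rw [inv_inv]
    set Q : BalancedPresentation n := update P i ((FreeGroup.of x)⁻¹ * P i * FreeGroup.of x)
      with hQ
    have key : update Q i (FreeGroup.of x * Q i * (FreeGroup.of x)⁻¹) = P := by
      simp only [hQ, update_self, update_idem]
      convert update_eq_self i P using 2
      group
    have h := (AndrewsCurtisMove.conj Q i x).isAndrewsCurtisEquivalent
    rw [key] at h
    exact h.symm
  | mul x y hx hy =>
    have h₁ := hy P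
    have h₂ := hx (update P i (y * P i * y⁻¹))
    simp only [update_idem, update_self] at h₂
    have e : x * y * P i * (x * y)⁻¹ = x * (y * P i * y⁻¹) * x⁻¹ := by group
    rw [e]
    exact h₁.trans h₂

end IsAndrewsCurtisEquivalent

/-! ### Endomorphisms of the free group applied to all relators -/

section Map

variable {F : Type*} [FunLike F (FreeGroup (Fin n)) (FreeGroup (Fin n))]
  [MonoidHomClass F (FreeGroup (Fin n)) (FreeGroup (Fin n))]

/-- An endomorphism `φ` of the free group carries an Andrews–Curtis move `P ↝ Q` to an
Andrews–Curtis equivalence `φ ∘ P ∼ φ ∘ Q` (the image of "conjugate by `x`" is "conjugate by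
the word `φ x`"). [folklore] -/
theorem AndrewsCurtisMove.map (φ : F) {P Q : BalancedPresentation n} (h : AndrewsCurtisMove P Q) :
    IsAndrewsCurtisEquivalent (⇑φ ∘ P) (⇑φ ∘ Q) := by
  cases h with
  | inv i =>
    rw [comp_update, map_inv]
    exact IsAndrewsCurtisEquivalent.update_inv (⇑φ ∘ P) i
  | mul i j hij =>
    rw [comp_update, map_mul]
    exact IsAndrewsCurtisEquivalent.update_mul (⇑φ ∘ P) hij
  | conj i g =>
    rw [comp_update, map_mul, map_mul, map_inv]
    exact IsAndrewsCurtisEquivalent.update_conj (⇑φ ∘ P) i (φ (FreeGroup.of g))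

/-- **Applying an endomorphism of the free group to all relators preserves Andrews–Curtis
equivalence.** [folklore] -/
theorem IsAndrewsCurtisEquivalent.map (φ : F) {P Q : BalancedPresentation n}
    (h : IsAndrewsCurtisEquivalent P Q) : IsAndrewsCurtisEquivalent (⇑φ ∘ P) (⇑φ ∘ Q) := by
  induction h with
  | rel _ _ h => exact h.map φ
  | refl _ => exact IsAndrewsCurtisEquivalent.refl _
  | symm _ _ _ ih => exact ih.symm
  | trans _ _ _ _ _ ih₁ ih₂ => exact ih₁.trans ih₂

/-- If `φ` carries the trivial presentation to an Andrews–Curtis trivial one, then `φ` preserves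
Andrews–Curtis triviality. [folklore] -/
theorem IsAndrewsCurtisEquivalent.comp_of_trivial (φ : F)
    (hφ : IsAndrewsCurtisEquivalent (⇑φ ∘ BalancedPresentation.trivial n)
      (BalancedPresentation.trivial n))
    {P : BalancedPresentation n}
    (h : IsAndrewsCurtisEquivalent P (BalancedPresentation.trivial n)) :
    IsAndrewsCurtisEquivalent (⇑φ ∘ P) (BalancedPresentation.trivial n) :=
  (h.map φ).trans hφ

end Map

/-! ### Permuting the relators

Two-entry bookkeeping: we write `update (update P a x) b y` for the presentation `P` with the
relators in positions `a ≠ b` replaced by `x` and `y`. -/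

namespace BalancedPresentation

variable {a b : Fin n}

/-- The `a`-entry of `update (update P a x) b y` is `x` (`a ≠ b`). [folklore] -/
theorem update₂_apply_left (P : BalancedPresentation n) (hab : a ≠ b) (x y : FreeGroup (Fin n)) :
    update (update P a x) b y a = x := by
  simp [update_of_ne hab]

/-- The `b`-entry of `update (update P a x) b y` is `y`. [folklore] -/
theorem update₂_apply_right (P : BalancedPresentation n) (x y : FreeGroup (Fin n)) :
    update (update P a x) b y b = y := by
  simp

/-- Overwriting the `a`-entry of `update (update P a x) b y`. [folklore] -/
theorem update_update₂_left (P : BalancedPresentation n) (hab : a ≠ b)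
    (x y z : FreeGroup (Fin n)) :
    update (update (update P a x) b y) a z = update (update P a z) b y := by
  rw [update_comm hab.symm, update_idem]

/-- Overwriting the `b`-entry of `update (update P a x) b y`. [folklore] -/
theorem update_update₂_right (P : BalancedPresentation n) (x y z : FreeGroup (Fin n)) :
    update (update (update P a x) b y) b z = update (update P a x) b z := by
  rw [update_idem]

/-- Overwriting with the old entries does nothing. [folklore] -/
theorem update₂_eq_self (P : BalancedPresentation n) : update (update P a (P a)) b (P b) = P := by
  simp only [update_eq_self]

/-- Overwriting the `b`-entry with its old value. [folklore] -/
theorem update₂_eq_update (P : BalancedPresentation n) (hab : a ≠ b) (x : FreeGroup (Fin n)) :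
    update (update P a x) b (P b) = update P a x := by
  conv_lhs => rw [show P b = update P a x b from (update_of_ne hab.symm x P).symm]
  exact update_eq_self b _

/-- Swapping the two entries is precomposition with the transposition. [folklore] -/
theorem update₂_eq_comp_swap (P : BalancedPresentation n) (hab : a ≠ b) :
    update (update P a (P b)) b (P a) = P ∘ Equiv.swap a b := by
  rw [Equiv.comp_swap_eq_update, update_comm hab]

end BalancedPresentation

namespace IsAndrewsCurtisEquivalent

open BalancedPresentation

variable {a b : Fin n}

/-- Two-entry form of the move `r_b ↦ r_b r_a`. [folklore] -/
theorem update₂_mul_right (P : BalancedPresentation n) (hab : a ≠ b) (x y : FreeGroup (Fin n)) :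
    IsAndrewsCurtisEquivalent (update (update P a x) b y) (update (update P a x) b (y * x)) := by
  have h := update_mul (update (update P a x) b y) hab.symm
  rwa [update₂_apply_right, update₂_apply_left P hab, update_update₂_right] at h

/-- Two-entry form of the move `r_a ↦ r_a r_b`. [folklore] -/
theorem update₂_mul_left (P : BalancedPresentation n) (hab : a ≠ b) (x y : FreeGroup (Fin n)) :
    IsAndrewsCurtisEquivalent (update (update P a x) b y) (update (update P a (x * y)) b y) := by
  have h := update_mul (update (update P a x) b y) hab
  rwa [update₂_apply_right, update₂_apply_left P hab, update_update₂_left P hab] at h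

/-- Two-entry form of the move `r_a ↦ r_a⁻¹`. [folklore] -/
theorem update₂_inv_left (P : BalancedPresentation n) (hab : a ≠ b) (x y : FreeGroup (Fin n)) :
    IsAndrewsCurtisEquivalent (update (update P a x) b y) (update (update P a x⁻¹) b y) := by
  have h := update_inv (update (update P a x) b y) a
  rwa [update₂_apply_left P hab, update_update₂_left P hab] at h

/-- Two-entry form of the move `r_b ↦ r_b⁻¹`. [folklore] -/
theorem update₂_inv_right (P : BalancedPresentation n) (x y : FreeGroup (Fin n)) :
    IsAndrewsCurtisEquivalent (update (update P a x) b y) (update (update P a x) b y⁻¹) := by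
  have h := update_inv (update (update P a x) b y) b
  rwa [update₂_apply_right, update_update₂_right] at h

/-- Two-entry form of the conjugation of `r_a` by a word. [folklore] -/
theorem update₂_conj_left (P : BalancedPresentation n) (hab : a ≠ b)
    (x y w : FreeGroup (Fin n)) :
    IsAndrewsCurtisEquivalent (update (update P a x) b y)
      (update (update P a (w * x * w⁻¹)) b y) := by
  have h := update_conj (update (update P a x) b y) a w
  rwa [update₂_apply_left P hab, update_update₂_left P hab] at h

/-- **Transposing two relators is an Andrews–Curtis equivalence**: seven moves,
`(u, v) ↝ (u, vu) ↝ (u⁻¹, vu) ↝ (u⁻¹vu, vu) ↝ (v, vu) ↝ (v, (vu)⁻¹) ↝ (v, u⁻¹) ↝ (v, u)`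
(the fourth conjugates by the word `u`). [folklore] -/
theorem comp_swap (P : BalancedPresentation n) (a b : Fin n) :
    IsAndrewsCurtisEquivalent P (P ∘ Equiv.swap a b) := by
  rcases eq_or_ne a b with rfl | hab
  · simpa using IsAndrewsCurtisEquivalent.refl P
  rw [← update₂_eq_comp_swap P hab]
  conv_lhs => rw [← update₂_eq_self (a := a) (b := b) P]
  refine (update₂_mul_right P hab _ _).trans ?_
  refine (update₂_inv_left P hab _ _).trans ?_
  refine (update₂_mul_left P hab _ _).trans ?_
  refine (update₂_conj_left P hab _ _ (P a)).trans ?_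
  have e₁ : P a * ((P a)⁻¹ * (P b * P a)) * (P a)⁻¹ = P b := by group
  rw [e₁]
  refine (update₂_inv_right P _ _).trans ?_
  refine (update₂_mul_right P hab _ _).trans ?_
  have e₂ : (P b * P a)⁻¹ * P b = (P a)⁻¹ := by group
  rw [e₂]
  simpa using update₂_inv_right (a := a) (b := b) P (P b) (P a)⁻¹

/-- **Permuting the relators is an Andrews–Curtis equivalence** (every permutation is a product
of transpositions). [folklore] -/
theorem comp_perm (P : BalancedPresentation n) (σ : Equiv.Perm (Fin n)) :
    IsAndrewsCurtisEquivalent P (P ∘ ⇑σ) := by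
  induction σ using Equiv.Perm.swap_induction_on generalizing P with
  | one => simpa using IsAndrewsCurtisEquivalent.refl P
  | swap_mul f x y _ ih =>
    rw [Equiv.Perm.coe_mul, ← Function.comp_assoc]
    exact (comp_swap P x y).trans (ih _)

end IsAndrewsCurtisEquivalent

end Literature.Topology.FourManifolds

end
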